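import Literature.MathematicalPhysics.QuantumFieldTheory.Balaban1983to89.B4Eq220CubeField
import Literature.MathematicalPhysics.QuantumFieldTheory.Balaban1983to89.B4BoxNeumannGauge

/-!
# `Balaban1983to89.B4Lemma22BoxNoCollar` — [Balaban1983RegularityDecay] LEMMA 2.2 (2.17) (sup members) AND THE
# FACTOR BOUND (2.20) FOR `G_k(□, A)` AT A (1.7)-REGULAR FIELD `A` ON A BOX WITH **NO COLLAR HYPOTHESIS**
# (p. 579 «if Ω is a rectangular parallelepiped, then all □_j in the representation (2.13) are cubes and we can
# apply Lemma 2.2 to all operators in it» — made good for the boundary cubes, where `Ã_j = A` is NOT constant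
# near `∂□_j`)

statement-level skeleton of published theorems with citation tags; proofs where landed; nothing here is a claim about the Yang–Mills mass gap

CITATION HEADER.  T. Bałaban, *Regularity and decay of lattice Green's functions*, Commun. Math. Phys. **89** (1983)
571–597, doi:10.1007/bf01214744 [Balaban1983RegularityDecay] (cell paper B4; held text
`paper:balaban1983-cmp89-regularity-decay`, journal page = PDF page + 570; pp. 572–573, 575, 577–582).  Unit
`lit-balaban-r04` gen 15 (B4 second reader; HOME `run/shared/lean/pub/lit-balaban/`), SKELETON rows **B4.Lem2.2**
((2.17) sup members), **B4.Eq2.18** ((2.20)), **B4.Thm@573** (the per-cube inputs `hG`/`hKG` of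
`B4Thm110BoxCut.thm110_value_boxCut` at the BOUNDARY cubes); HOME/GAPS.md **G-B4-p17-02** (the collar hypothesis of
the box theorems) — steps (2)–(3) of the collar-drop programme (r01 ruling 2026-08-22T10:13Z).  Imports the pv08
lineage via p35's `B4Eq220CubeField` (`B4Lemma22CrossSup`: `cross_site_eq`, `cross_first_le`, `sum_box_nbrs`,
`pertE_sub_mulVec_le`; `B4Lemma22PertVSup.lemma22_17_sup_cross`; `B4Lemma22SupStair.stair_lsum_le`;
`B4Lower18Regular.green_box_l2_bound`; `B4Eq220CommutatorField.eq220_field_reduction_sup`;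
`B4Eq220PartitionSizes.hsize_hBox`; `B4CubeFieldHyps22`: charge scaling, `smallness_of_le`, `cube_threshold`,
`aSeq_window`; `B4Lemma22ReduceZero.sup_hyps_conj`, `covDeriv_gauge`) and r04 g14's `B4BoxNeumannGauge` (the
discrete Neumann gauge: `gauged`, `gaugeFn`, `gauged_face_lo/hi`, `gauged_regular`).

WHAT IS PRINTED.  pp. 577–578, Lemma 2.2 (p. 577): «Let a rectangular parallelepiped □ be a sum of few large blocks (e.g., as
in the case of the cubes □_j), and let Ã be a regular vector field configuration in the sense of Proposition I.2.1,
constant in a neighbourhood of the boundary of □. Then for e sufficiently small and α < 1, there exists a constant c₁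
depending on d, α only, such that ‖G_k(□,Ã)f‖_{1,α} ≤ c₁‖f‖_∞, (2.16)» (p. 578:) «and a constant c₂ depending on d,
p₁, such that ‖G_k(□,Ã)f‖_q, ‖D^η_{Ã,μ}G_k(□,Ã)f‖_q, ‖G_k(□,Ã)D^{η*}_{Ã,μ}f‖_q ≤ c₂‖f‖_p (2.17) for 1 ≤ p, q ≤ ∞,
satisfying the condition 1/p − 1/p₁ ≤ 1/q ≤ 1/p with p₁ > d.»  THIS FILE concerns the members ‖G_k(□,Ã)f‖_q and
‖D^η_{Ã,μ}G_k(□,Ã)f‖_q of (2.17) at (p, q) = (∞, ∞) (admissible: 1/p − 1/p₁ < 0 = 1/q = 1/p), written `(2.17)_∞` or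
"sup members" below (our labels).  [v1.1, unit `lit-balaban-r04` gen 17, DOCSTRING-ONLY, every declaration byte-identical with v1.0
p326682: v1.0 displayed at this place, inside guillemets and under the label (2.17), a pointwise bound with the factor
`c₂ exp(−δ₀ dist(x, supp f))` — that is the SHAPE OF THE THEOREM'S (1.10) p. 573 (constant c₀), NOT the printed (2.17),
which carries no decay factor; corrected here against the ×2 renders `…/1983-cmp89-regularity-decay-p007-x2.png`,
`-p008-x2.png`.  The theorems were and are the decay-free sup bounds, i.e. (2.17) at (∞, ∞), as their statements say; also the
guillemets around our own wording of the tree hypothesis `hbd` in §1's first docstring are replaced by plain quotes.]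
Further: p. 581, the proof at `Ã = A₀ + A'`:
«The only trouble is with the term D^{η*}_{A₀}F_{1,k}(−A'), … Using the formula (2.4) and the fact that A' has a
compact support in □, we have (2.32) (D^{η*}_{A₀}F_{1,k}(−A')f)(x) = (∂^{η*}F_{1,k}(−A'))(x)f(x) +
Σ_μ F_{1,k}(−A'_{⟨x−ηe_μ,x⟩})(D^{η*}_{A₀,μ}f)(x) … Thus it is a first order differential operator with small
coefficients. Only here we needed the assumption that Ã is constant in a neighbourhood of ∂□.»; p. 579: «if Ω is a
rectangular parallelepiped, then all □_j in the representation (2.13) are cubes and we can apply Lemma 2.2 to all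
operators in it»; p. 572 (1.7) «|(∂^η_μA)(x)| ≤ ce^{β−1}»; p. 573 Theorem «for e sufficiently small».

THE POINT OF THIS FILE (analysis ours, disclosed).  In the tree's kernel proof of (2.17)_∞ (`B4Lemma22CrossSup`)
the hypothesis «A' has a compact support in □» enters at exactly one place: in the sitewise summation by parts of the
divergence term `(∂^{η*}F_{1,k}(−A'))(x)f(x)` (`dir_pair_le`), at a site `x` on a `μ`-face the lone `μ`-neighbour term
`η^{−2}/2·(E(x+ηe_μ,x) − E(x,x+ηe_μ))f(x)`, `E = 1 − U(κA')ᵀ`, has no partner and is killed by `A'_μ = 0` there.  But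
that term is `≤ η^{−2}ℓ|κA'_{⟨x,x+ηe_μ⟩}|·|f(x)|` (`pertE_sub_mulVec_le`), so it is ZEROTH-ORDER SMALL — of the same
size `ℓθ'|f(x)|` as the interior second-difference terms — as soon as `|κA'_μ| ≤ θ_f η²` on the `μ`-bonds touching the
`μ`-faces (§1: `dir_pair_le_face` … `lemma22_17_sup_stair_face`, the pv08 chain with «compact support» replaced by
this face bound, smallness slot `(d+1)ℓ(θ + (θ' + θ_f))`).  For a field `A` that is merely (1.7)-regular on `□`
(`|∂A| ≤ ce^{β−1}η`, NO collar) the discrete Neumann gauge of `B4BoxNeumannGauge` produces `A'' = A + dλ` with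
`|A''_μ| ≤ 14d·ce^{β−1}η` on both normal bond layers of every face and `|∂A''| ≤ C₁(d)ce^{β−1}η` inside; at charge
`eη` this is `θ_f = 14d·ce^β`, `θ' = C₁(d)ce^β`, and — walking in from the face along the normal line —
`|eηA''| ≤ (14d + S·C₁(d))ce^β·η = θη` on a box of `≤ S` unit blocks per side (§2).  So Lemma 2.2's sup members hold
for `G_k(□, A'')` with `A₀ = 0` (§3), and by gauge covariance (`b4Green_bondGauge`, `covDeriv_gauge`, the sup norm
being gauge invariant, `sup_hyps_conj`) for `G_k(□, A)` ITSELF — the print's boundary-cube choice «Ã_j = A»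
(p. 575) — with a constant depending on `(d, N, flow, L, windows)` and a threshold `e₁(c, β, S)` only (§3
`lemma22_sup_noCollar`); the factor bound (2.20) follows by p35's reduction for ANY label `j` of [B4]'s `h_j`,
face labels included (§4 `eq220_noCollar`).  Nothing printed is claimed to fail; the print's Lemma 2.2 keeps its
hypothesis, this file adds the case the parallelepiped sentence of p. 579 needs.

WHAT THIS MODULE PROVES (all in full; `d + 1` lattice dimensions, fine box `Π_μ[0, nM_μ)`, `n = L^k`, `L = ℓ+1 ≥ 2`).
* §1 `dir_pair_le_face`, `cross_zeroth_le_face`, `cross_site_le_face`, `firstOrderSmall_cross_face`,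
  **`lemma22_17_sup_box_face`**, **`lemma22_17_sup_stair_face`** — (2.17)_∞, `n = 0,1`, for `G_k(□, A₀ + A')` with
  the face bound `|κA'_μ| ≤ θ_fη²` on the face-touching normal bonds in place of `A' = 0` there.
* §2 `gauged_abs_le` (sup size of the Neumann-gauged field), `gSig`/`gBond` (the gauged field as a bond function on
  the fine box at charge `κ`; `bondGauge_gBond`: `A = (A'')^{λ}` exactly), `gBond_hyps` (antisymmetry, size,
  derivative and face bounds at charge `e/n` from (1.7)), `noCollar_threshold` («for e sufficiently small»).
* §3 **`lemma22_sup_noCollar`** — `‖G_k(□,A)Φ‖_∞ ≤ C‖Φ‖_∞`, `‖D^η_{A,μ}G_k(□,A)Φ‖_∞ ≤ C‖Φ‖_∞` for EVERY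
  (1.7)-regular component field `A` on a box of sides `M_μ ≤ S` (fine sides `≥ 3`), `0 < e ≤ e₁(c, β, S)`.
* §4 **`eq220_noCollar`** — `‖K_{h_j}G_k(□,A)(h_jΦ)‖_∞ ≤ (C/K)‖Φ‖_∞` for [B4]'s `h_j = hBox n K M j`, ANY label `j`,
  box sides multiples of `K`, same field hypotheses.
HONEST SCOPE.  (i) Sup members `n = 0,1` of (2.17) and the sup factor of (2.20) only (Hölder / `L^p` members: the
same substitution in `B4Lemma22LpStair`/`B4Lemma22EtaBox` is routine but not done here); (ii) the lineage's (1.6)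
(abelian one-parameter orthogonal flow `F`, component field, corner embedding and staircase contours, running
coefficient `a_kη^{d+1}`, charge `eη`); (iii) constants: `C` on `(d, N, ℓ₁, L, a₋, a₊, m²₊)`, `e₁` on these and
`(c, β, S)` — NOT on the position of the box or on `k`; (iv) the gauge `λ` is ours (`B4BoxNeumannGauge`), the print
gauges only the constant part away.  Definitions with bodies (`gSig`, `gBond`) and theorems; no `Prop` fact, no
`sorry`; axioms standard.
v1.2 (unit `lit-balaban-r04` gen 20, DOCSTRING-ONLY; every declaration byte-identical with v1.1 p332737): the locator of
(1.7) corrected from "p. 573" to p. 572 in this header and in eight `[cite:]` tags (summit-lit1 CITELOC register row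
P69-003; print re-read on the ×2 renders `…/1983-cmp89-regularity-decay-p002-x2.png` / `-p003-x2.png`: (1.7) is the last
display of p. 572; (1.8) and the Theorem with (1.9)–(1.12) stand on p. 573).
-/

namespace Literature.MathematicalPhysics.QuantumFieldTheory.Balaban1983to89.B4Lemma22BoxNoCollar

open Finset Matrix
open Literature.MathematicalPhysics.QuantumFieldTheory.Balaban1983to89.B4GaugeCovariance (fld fld_blockOp_mulVec
  OrthFlow fieldLink boxWt blkWt constBond contourTrans pathEnd bondGauge blockDiag IsGauge gaugeKer
  fieldLink_bondGauge b4Green_bondGauge sum_boxWt_right)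
open Literature.MathematicalPhysics.QuantumFieldTheory.Balaban1983to89.B4Lower18Regular (e1 e1_apply_self e1_apply_ne
  pertE crossOp lsum baseEmb stairContour stairContour_end green_box_l2_bound)
open Literature.MathematicalPhysics.QuantumFieldTheory.Balaban1983to89.B4Lower18RegularRegion (compField compField_add
  compField_sub)
open Literature.MathematicalPhysics.QuantumFieldTheory.Balaban1983to89.B4Lemma21Region (siteNorm covDeriv)
open Literature.MathematicalPhysics.QuantumFieldTheory.Balaban1983to89.B4Reflection242 (nbrs mem_nbrs boxDom
  mem_boxDom nbrs_comm)
open Literature.MathematicalPhysics.QuantumFieldTheory.Balaban1983to89.B4Lemma22Reduce231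
open Literature.MathematicalPhysics.QuantumFieldTheory.Balaban1983to89.B4Lemma22ReduceZero (siteNorm_sum_le Box
  greenA opA derivA derivA0 sup_hyps_conj covDeriv_gauge)
open Literature.MathematicalPhysics.QuantumFieldTheory.Balaban1983to89.B4Lemma22PertVSup (lemma22_17_sup_cross
  constBond_antisymm pertE_mulVec_le boxWt_nonneg)
open Literature.MathematicalPhysics.QuantumFieldTheory.Balaban1983to89.B4Lemma22CrossSup (pertE_sub_mulVec_le
  cross_site_eq cross_first_le sum_box_nbrs)
open Literature.MathematicalPhysics.QuantumFieldTheory.Balaban1983to89.B4Lemma22SupStair (stair_lsum_le)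
open Literature.MathematicalPhysics.QuantumFieldTheory.Balaban1983to89.B4Commutators25to211 (mulH)
open Literature.MathematicalPhysics.QuantumFieldTheory.Balaban1983to89.B4Eq220PartitionSizes (hBox hsize_hBox)
open Literature.MathematicalPhysics.QuantumFieldTheory.Balaban1983to89.B4Eq220CommutatorField (kOp
  eq220_field_reduction_sup sizes_Minv_field supN_mulH_le)
open Literature.MathematicalPhysics.QuantumFieldTheory.Balaban1983to89.B4PartitionUnity22 (hprof D1 D2 D1_nonneg
  D2_nonneg contDiff_hprof hasCompactSupport_hprof)
open Literature.MathematicalPhysics.QuantumFieldTheory.Balaban1983to89.B4CubeFieldHyps22 (greenA_smul derivA_smul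
  kOp_smul cube_threshold smallness_of_le aSeq_window)
open Literature.MathematicalPhysics.QuantumFieldTheory.Balaban1983to89.B4BoxNeumannGauge (gauged gaugeFn C1 C2
  gauged_face_lo gauged_face_hi gauged_regular)

noncomputable section

variable {ι : Type} [Fintype ι] [DecidableEq ι]

/-! ## §1. The pv08 chain with the face bound `|κA'_μ| ≤ θ_fη²` in place of «A' has a compact support in □» -/

section Face

variable {d : ℕ}

/-- **THE DIVERGENCE PART OF (2.32) IN ONE DIRECTION, FACE VERSION**: at a site `z` and a direction `μ`, the terms
of the two `μ`-neighbours regroup into differences of `E = 1 − U(κA')ᵀ` at the consecutive parallel bonds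
`(z−e_μ,z), (z,z+e_μ)`, each `≤ ℓθ'/n²·|u(z)|`; at a `μ`-face the lone term is `E(y,z) − E(z,y)`, `y = z ± e_μ`,
`≤ ℓ(|κA'(y,z)| + |κA'(z,y)|)·|u(z)| ≤ 2ℓθ_f/n²·|u(z)|` under the FACE BOUND `|κA'| ≤ θ_f/n²` on the `μ`-bonds
touching the `μ`-faces (instead of the print's «A' has a compact support in □», which is the case `θ_f = 0`).
[cite: Balaban1983RegularityDecay, p. 581 (2.32) «Only here we needed the assumption that Ã is constant in a neighbourhood of ∂□»] -/
theorem dir_pair_le_face (F : OrthFlow ι) {ℓ : ℝ} (hℓ : 0 ≤ ℓ)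
    (hLip : ∀ t (v : ι → ℝ), ((F.U t - 1) *ᵥ v) ⬝ᵥ ((F.U t - 1) *ᵥ v) ≤ (ℓ * t) ^ 2 * (v ⬝ᵥ v))
    (κ : ℝ) (n : ℕ) (N : Fin (d + 1) → ℕ) {A' : ↥(boxDom N) → ↥(boxDom N) → ℝ} {θ' θf : ℝ} (hθ' : 0 ≤ θ')
    (hθf : 0 ≤ θf)
    (hder : ∀ (x z y : ↥(boxDom N)) (μ : Fin (d + 1)), z.1 = x.1 + e1 μ → y.1 = z.1 + e1 μ →
      |κ * (A' y z - A' z x)| ≤ θ' / (n : ℝ) ^ 2 ∧ |κ * (A' x z - A' z y)| ≤ θ' / (n : ℝ) ^ 2)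
    (hface : ∀ (x y : ↥(boxDom N)) (μ : Fin (d + 1)), y.1 = x.1 + e1 μ →
      (x.1 - e1 μ ∉ boxDom N ∨ y.1 + e1 μ ∉ boxDom N) →
      |κ * A' x y| ≤ θf / (n : ℝ) ^ 2 ∧ |κ * A' y x| ≤ θf / (n : ℝ) ^ 2)
    (u : ↥(boxDom N) × ι → ℝ) (z : ↥(boxDom N)) (μ : Fin (d + 1)) :
    siteNorm ((if h : z.1 + e1 μ ∈ boxDom N then
        (pertE (fieldLink F κ A') ⟨_, h⟩ z - pertE (fieldLink F κ A') z ⟨_, h⟩) *ᵥ fld u z else 0)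
      + (if h : z.1 - e1 μ ∈ boxDom N then
        (pertE (fieldLink F κ A') ⟨_, h⟩ z - pertE (fieldLink F κ A') z ⟨_, h⟩) *ᵥ fld u z else 0))
      ≤ 2 * (ℓ * ((θ' + θf) / (n : ℝ) ^ 2)) * siteNorm (fld u z) := by
  have hu := siteNorm_nonneg (fld u z)
  have hn2 : 0 ≤ (n : ℝ) ^ 2 := sq_nonneg _
  have hdiv' : θ' / (n : ℝ) ^ 2 ≤ (θ' + θf) / (n : ℝ) ^ 2 := div_le_div_of_nonneg_right (by linarith) hn2
  have hdivf : θf / (n : ℝ) ^ 2 ≤ (θ' + θf) / (n : ℝ) ^ 2 := div_le_div_of_nonneg_right (by linarith) hn2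
  have hs0 : 0 ≤ (θ' + θf) / (n : ℝ) ^ 2 := div_nonneg (by linarith) hn2
  have h0 : 0 ≤ 2 * (ℓ * ((θ' + θf) / (n : ℝ) ^ 2)) * siteNorm (fld u z) :=
    mul_nonneg (mul_nonneg zero_le_two (mul_nonneg hℓ hs0)) hu
  by_cases hp : z.1 + e1 μ ∈ boxDom N <;> by_cases hm : z.1 - e1 μ ∈ boxDom N
  · rw [dif_pos hp, dif_pos hm]
    have hzm : z.1 = (⟨z.1 - e1 μ, hm⟩ : ↥(boxDom N)).1 + e1 μ := (sub_add_cancel _ _).symm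
    obtain ⟨h1, h2⟩ := hder ⟨_, hm⟩ z ⟨_, hp⟩ μ hzm rfl
    have hre : (pertE (fieldLink F κ A') ⟨_, hp⟩ z - pertE (fieldLink F κ A') z ⟨_, hp⟩) *ᵥ fld u z
        + (pertE (fieldLink F κ A') ⟨_, hm⟩ z - pertE (fieldLink F κ A') z ⟨_, hm⟩) *ᵥ fld u z
        = (pertE (fieldLink F κ A') ⟨_, hp⟩ z - pertE (fieldLink F κ A') z ⟨_, hm⟩) *ᵥ fld u z
          + (pertE (fieldLink F κ A') ⟨_, hm⟩ z - pertE (fieldLink F κ A') z ⟨_, hp⟩) *ᵥ fld u z := by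
      simp only [sub_mulVec]; abel
    rw [hre]
    refine (siteNorm_add_le _ _).trans ?_
    have e₁ := pertE_sub_mulVec_le F hℓ hLip κ A' ⟨_, hp⟩ z z ⟨_, hm⟩ (fld u z)
    have e₂ := pertE_sub_mulVec_le F hℓ hLip κ A' ⟨_, hm⟩ z z ⟨_, hp⟩ (fld u z)
    nlinarith [mul_le_mul_of_nonneg_right (mul_le_mul_of_nonneg_left (h1.trans hdiv') hℓ) hu,
      mul_le_mul_of_nonneg_right (mul_le_mul_of_nonneg_left (h2.trans hdiv') hℓ) hu]
  · rw [dif_pos hp, dif_neg hm, add_zero]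
    obtain ⟨h1, h2⟩ := hface z ⟨_, hp⟩ μ rfl (Or.inl hm)
    refine (pertE_sub_mulVec_le F hℓ hLip κ A' ⟨_, hp⟩ z z ⟨_, hp⟩ (fld u z)).trans ?_
    have hs : |κ * (A' ⟨_, hp⟩ z - A' z ⟨_, hp⟩)| ≤ 2 * ((θ' + θf) / (n : ℝ) ^ 2) := by
      rw [mul_sub]
      refine (abs_sub _ _).trans ?_
      linarith [h2.trans hdivf, h1.trans hdivf]
    calc ℓ * |κ * (A' ⟨_, hp⟩ z - A' z ⟨_, hp⟩)| * siteNorm (fld u z)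
        ≤ ℓ * (2 * ((θ' + θf) / (n : ℝ) ^ 2)) * siteNorm (fld u z) :=
          mul_le_mul_of_nonneg_right (mul_le_mul_of_nonneg_left hs hℓ) hu
      _ = 2 * (ℓ * ((θ' + θf) / (n : ℝ) ^ 2)) * siteNorm (fld u z) := by ring
  · rw [dif_neg hp, dif_pos hm, zero_add]
    have hzm : z.1 = (⟨z.1 - e1 μ, hm⟩ : ↥(boxDom N)).1 + e1 μ := (sub_add_cancel _ _).symm
    obtain ⟨h1, h2⟩ := hface ⟨_, hm⟩ z μ hzm (Or.inr hp)
    refine (pertE_sub_mulVec_le F hℓ hLip κ A' ⟨_, hm⟩ z z ⟨_, hm⟩ (fld u z)).trans ?_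
    have hs : |κ * (A' ⟨_, hm⟩ z - A' z ⟨_, hm⟩)| ≤ 2 * ((θ' + θf) / (n : ℝ) ^ 2) := by
      rw [mul_sub]
      refine (abs_sub _ _).trans ?_
      linarith [h1.trans hdivf, h2.trans hdivf]
    calc ℓ * |κ * (A' ⟨_, hm⟩ z - A' z ⟨_, hm⟩)| * siteNorm (fld u z)
        ≤ ℓ * (2 * ((θ' + θf) / (n : ℝ) ^ 2)) * siteNorm (fld u z) :=
          mul_le_mul_of_nonneg_right (mul_le_mul_of_nonneg_left hs hℓ) hu
      _ = 2 * (ℓ * ((θ' + θf) / (n : ℝ) ^ 2)) * siteNorm (fld u z) := by ring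
  · rw [dif_neg hp, dif_neg hm, add_zero, siteNorm_zero]
    exact h0

/-- **THE DIVERGENCE PART IS ZEROTH-ORDER SMALL, SITEWISE, FACE VERSION**:
`|Σ_y c(z,y)(E(y,z) − E(z,y))u(z)| ≤ (d+1)ℓ(θ' + θ_f)|u(z)|`.
[cite: Balaban1983RegularityDecay, p. 581 (2.32); p. 579 (2.23)] -/
theorem cross_zeroth_le_face (F : OrthFlow ι) {ℓ : ℝ} (hℓ : 0 ≤ ℓ)
    (hLip : ∀ t (v : ι → ℝ), ((F.U t - 1) *ᵥ v) ⬝ᵥ ((F.U t - 1) *ᵥ v) ≤ (ℓ * t) ^ 2 * (v ⬝ᵥ v))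
    (κ : ℝ) {n : ℕ} (hn : 1 ≤ n) (N : Fin (d + 1) → ℕ) {A' : ↥(boxDom N) → ↥(boxDom N) → ℝ} {θ' θf : ℝ}
    (hθ' : 0 ≤ θ') (hθf : 0 ≤ θf)
    (hder : ∀ (x z y : ↥(boxDom N)) (μ : Fin (d + 1)), z.1 = x.1 + e1 μ → y.1 = z.1 + e1 μ →
      |κ * (A' y z - A' z x)| ≤ θ' / (n : ℝ) ^ 2 ∧ |κ * (A' x z - A' z y)| ≤ θ' / (n : ℝ) ^ 2)
    (hface : ∀ (x y : ↥(boxDom N)) (μ : Fin (d + 1)), y.1 = x.1 + e1 μ →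
      (x.1 - e1 μ ∉ boxDom N ∨ y.1 + e1 μ ∉ boxDom N) →
      |κ * A' x y| ≤ θf / (n : ℝ) ^ 2 ∧ |κ * A' y x| ≤ θf / (n : ℝ) ^ 2)
    (u : ↥(boxDom N) × ι → ℝ) (z : ↥(boxDom N)) :
    siteNorm (∑ y, boxWt n N z y • ((pertE (fieldLink F κ A') y z - pertE (fieldLink F κ A') z y) *ᵥ fld u z))
      ≤ ((d : ℝ) + 1) * ℓ * (θ' + θf) * siteNorm (fld u z) := by
  have hn0 : (n : ℝ) ≠ 0 := by
    have : (0 : ℝ) < n := by exact_mod_cast hn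
    exact this.ne'
  have hw : ∀ y, boxWt n N z y • ((pertE (fieldLink F κ A') y z - pertE (fieldLink F κ A') z y) *ᵥ fld u z)
      = ((n : ℝ) ^ 2 / 2) • (if y.1 ∈ nbrs z.1 then
          (pertE (fieldLink F κ A') y z - pertE (fieldLink F κ A') z y) *ᵥ fld u z else 0) := by
    intro y
    unfold boxWt
    split_ifs <;> simp
  simp_rw [hw]
  rw [← Finset.smul_sum, sum_box_nbrs N z
    (fun y => (pertE (fieldLink F κ A') y z - pertE (fieldLink F κ A') z y) *ᵥ fld u z), siteNorm_smul,
    abs_of_nonneg (by positivity)]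
  refine (mul_le_mul_of_nonneg_left ((siteNorm_sum_le _ _).trans
    (sum_le_sum fun μ _ => dir_pair_le_face F hℓ hLip κ n N hθ' hθf hder hface u z μ)) (by positivity)).trans ?_
  rw [sum_const, card_univ, Fintype.card_fin, nsmul_eq_mul]
  refine le_of_eq ?_
  field_simp
  push_cast
  ring

/-- **`|(Cu)(z)| ≤ (d+1)ℓθ·Σ_μ‖D^η_{A₀,μ}u‖_∞ + (d+1)ℓ(θ' + θ_f)·‖u‖_∞`**, face version of
`B4Lemma22CrossSup.cross_site_le`. [cite: Balaban1983RegularityDecay, p. 581 (2.32)] -/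
theorem cross_site_le_face (F : OrthFlow ι) {ℓ : ℝ} (hℓ : 0 ≤ ℓ)
    (hLip : ∀ t (v : ι → ℝ), ((F.U t - 1) *ᵥ v) ⬝ᵥ ((F.U t - 1) *ᵥ v) ≤ (ℓ * t) ^ 2 * (v ⬝ᵥ v))
    (κ : ℝ) {n : ℕ} (hn : 1 ≤ n) (N : Fin (d + 1) → ℕ) (A₀ : ↥(boxDom N) → ↥(boxDom N) → ℝ)
    (hanti : ∀ x y, A₀ y x = -A₀ x y) {A' : ↥(boxDom N) → ↥(boxDom N) → ℝ} {θ θ' θf : ℝ} (hθ : 0 ≤ θ)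
    (hA' : ∀ x y, y.1 ∈ nbrs x.1 → |κ * A' x y| ≤ θ / n) (hθ' : 0 ≤ θ') (hθf : 0 ≤ θf)
    (hder : ∀ (x z y : ↥(boxDom N)) (μ : Fin (d + 1)), z.1 = x.1 + e1 μ → y.1 = z.1 + e1 μ →
      |κ * (A' y z - A' z x)| ≤ θ' / (n : ℝ) ^ 2 ∧ |κ * (A' x z - A' z y)| ≤ θ' / (n : ℝ) ^ 2)
    (hface : ∀ (x y : ↥(boxDom N)) (μ : Fin (d + 1)), y.1 = x.1 + e1 μ →
      (x.1 - e1 μ ∉ boxDom N ∨ y.1 + e1 μ ∉ boxDom N) →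
      |κ * A' x y| ≤ θf / (n : ℝ) ^ 2 ∧ |κ * A' y x| ≤ θf / (n : ℝ) ^ 2)
    (u : ↥(boxDom N) × ι → ℝ) (z : ↥(boxDom N)) :
    siteNorm (fld (crossOp (boxWt n N) (fieldLink F κ A₀) (pertE (fieldLink F κ A')) *ᵥ u) z)
      ≤ ((d : ℝ) + 1) * ℓ * θ * ∑ μ, supN (covDeriv n (boxDom N) (fieldLink F κ A₀) μ *ᵥ u)
        + ((d : ℝ) + 1) * ℓ * (θ' + θf) * supN u := by
  rw [cross_site_eq F κ n N A₀ hanti A' u z]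
  refine (siteNorm_add_le _ _).trans (add_le_add (cross_first_le F hℓ hLip κ hn N A₀ hanti hθ hA' u z) ?_)
  exact (cross_zeroth_le_face F hℓ hLip κ hn N hθ' hθf hder hface u z).trans
    (mul_le_mul_of_nonneg_left (le_supN u z) (by positivity))

/-- **THE CROSS TERM `C` («D^{η*}_{A₀}F_{1,k}(−A')») IS FIRST-ORDER SMALL IN `‖·‖_∞` WITH CONSTANT
`(d+1)ℓ(θ + (θ' + θ_f))`, FACE VERSION** — hypotheses: `A₀` antisymmetric; `|κA'_b| ≤ θ/n` on nearest-neighbour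
bonds; `|κ(A'(b') − A'(b))| ≤ θ'/n²` on consecutive parallel bonds; `|κA'_b| ≤ θ_f/n²` (both orientations) on the
`μ`-bonds touching the `μ`-faces. [cite: Balaban1983RegularityDecay, p. 581 (2.32)] -/
theorem firstOrderSmall_cross_face (F : OrthFlow ι) {ℓ : ℝ} (hℓ : 0 ≤ ℓ)
    (hLip : ∀ t (v : ι → ℝ), ((F.U t - 1) *ᵥ v) ⬝ᵥ ((F.U t - 1) *ᵥ v) ≤ (ℓ * t) ^ 2 * (v ⬝ᵥ v))
    (κ : ℝ) {n : ℕ} (hn : 1 ≤ n) (N : Fin (d + 1) → ℕ) (A₀ : ↥(boxDom N) → ↥(boxDom N) → ℝ)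
    (hanti : ∀ x y, A₀ y x = -A₀ x y) {A' : ↥(boxDom N) → ↥(boxDom N) → ℝ} {θ θ' θf : ℝ} (hθ : 0 ≤ θ)
    (hA' : ∀ x y, y.1 ∈ nbrs x.1 → |κ * A' x y| ≤ θ / n) (hθ' : 0 ≤ θ') (hθf : 0 ≤ θf)
    (hder : ∀ (x z y : ↥(boxDom N)) (μ : Fin (d + 1)), z.1 = x.1 + e1 μ → y.1 = z.1 + e1 μ →
      |κ * (A' y z - A' z x)| ≤ θ' / (n : ℝ) ^ 2 ∧ |κ * (A' x z - A' z y)| ≤ θ' / (n : ℝ) ^ 2)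
    (hface : ∀ (x y : ↥(boxDom N)) (μ : Fin (d + 1)), y.1 = x.1 + e1 μ →
      (x.1 - e1 μ ∉ boxDom N ∨ y.1 + e1 μ ∉ boxDom N) →
      |κ * A' x y| ≤ θf / (n : ℝ) ^ 2 ∧ |κ * A' y x| ≤ θf / (n : ℝ) ^ 2) :
    FirstOrderSmall supN (crossOp (boxWt n N) (fieldLink F κ A₀) (pertE (fieldLink F κ A')))
      (covDeriv n (boxDom N) (fieldLink F κ A₀)) (((d : ℝ) + 1) * ℓ * (θ + (θ' + θf))) := by
  intro u
  have hu := supN_nonneg u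
  have hS : 0 ≤ ∑ μ, supN (covDeriv n (boxDom N) (fieldLink F κ A₀) μ *ᵥ u) :=
    sum_nonneg fun μ _ => supN_nonneg _
  have hε : 0 ≤ ((d : ℝ) + 1) * ℓ * (θ + (θ' + θf)) := by positivity
  refine supN_le (mul_nonneg hε (add_nonneg hu hS))
    fun z => (cross_site_le_face F hℓ hLip κ hn N A₀ hanti hθ hA' hθ' hθf hder hface u z).trans ?_
  have h1 : 0 ≤ ((d : ℝ) + 1) * ℓ * θ * supN u := mul_nonneg (by positivity) hu
  have h2 : 0 ≤ ((d : ℝ) + 1) * ℓ * (θ' + θf) * ∑ μ, supN (covDeriv n (boxDom N) (fieldLink F κ A₀) μ *ᵥ u) :=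
    mul_nonneg (by positivity) hS
  nlinarith

/-- **LEMMA 2.2 (2.17)_∞ (`n = 0,1`, both derivative conventions) FOR `G_k(□,Ã)`, `Ã = A₀ + A'`, ON A FINE BOX,
FACE VERSION**: `B4Lemma22CrossSup.lemma22_17_sup_box` with "A' = 0 on the `μ`-bonds touching the `μ`-faces" (the tree's hypothesis `hbd`, our wording)
replaced by `|κA'| ≤ θ_f/n²` there and the smallness slot `(d+1)ℓ(θ + (θ' + θ_f))`.
[cite: Balaban1983RegularityDecay, Lemma 2.2 (2.17) p. 578; proof pp. 579–582 (2.23)–(2.25), (2.31)–(2.33)] -/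
theorem lemma22_17_sup_box_face (F : OrthFlow ι) {ℓ₁ : ℝ} (hℓ₁ : 0 ≤ ℓ₁)
    (hLip : ∀ t (v : ι → ℝ), ((F.U t - 1) *ᵥ v) ⬝ᵥ ((F.U t - 1) *ᵥ v) ≤ (ℓ₁ * t) ^ 2 * (v ⬝ᵥ v))
    (κ : ℝ) (d ℓ : ℕ) (hℓ : 1 ≤ ℓ) (amin aplus m2plus : ℝ) (ha : 0 < amin) :
    ∃ c : ℝ, 0 < c ∧ ∀ (k : ℕ), 1 ≤ k → ∀ (a m2 : ℝ), amin ≤ a → a ≤ aplus → 0 ≤ m2 → m2 ≤ m2plus →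
      ∀ (M : Fin (d + 1) → ℕ), (∀ i, 1 ≤ M i) →
      ∀ (emb : ↥(boxDom M) → ↥(Box d ℓ k M)) (Γ : ↥(boxDom M) → ↥(Box d ℓ k M) → List ↥(Box d ℓ k M)),
        (∀ y x, blkWt ((ℓ + 1) ^ k) M (fun i => (ℓ + 1) ^ k * M i) y x ≠ 0 → pathEnd (emb y) (Γ y x) = x) →
      ∀ (A₀ : Fin (d + 1) → ℝ) (A' : ↥(Box d ℓ k M) → ↥(Box d ℓ k M) → ℝ) (θ θ' θf τ : ℝ),
        IsUnit (opA d F κ ℓ k a m2 M emb Γ (constBond A₀ Subtype.val + A')).det →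
        0 ≤ θ → (∀ x y : ↥(Box d ℓ k M), y.1 ∈ nbrs x.1 → |κ * A' x y| ≤ θ / ((ℓ + 1) ^ k : ℕ)) →
        0 ≤ θ' → (∀ (x z y : ↥(Box d ℓ k M)) (μ : Fin (d + 1)), z.1 = x.1 + e1 μ → y.1 = z.1 + e1 μ →
          |κ * (A' y z - A' z x)| ≤ θ' / (((ℓ + 1) ^ k : ℕ) : ℝ) ^ 2 ∧
          |κ * (A' x z - A' z y)| ≤ θ' / (((ℓ + 1) ^ k : ℕ) : ℝ) ^ 2) →
        0 ≤ θf → (∀ (x y : ↥(Box d ℓ k M)) (μ : Fin (d + 1)), y.1 = x.1 + e1 μ →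
          (x.1 - e1 μ ∉ Box d ℓ k M ∨ y.1 + e1 μ ∉ Box d ℓ k M) →
          |κ * A' x y| ≤ θf / (((ℓ + 1) ^ k : ℕ) : ℝ) ^ 2 ∧ |κ * A' y x| ≤ θf / (((ℓ + 1) ^ k : ℕ) : ℝ) ^ 2) →
        0 ≤ τ → (∀ y x, blkWt ((ℓ + 1) ^ k) M (fun i => (ℓ + 1) ^ k * M i) y x ≠ 0 →
          |κ * lsum A' (emb y) (Γ y x)| ≤ τ) →
        ((d : ℝ) + 2) * c * (((d : ℝ) + 1) * ℓ₁ * (θ + (θ' + θf)) + ((d : ℝ) + 1) * ℓ₁ * θ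
          + ((d : ℝ) + 1) * ℓ₁ ^ 2 * θ ^ 2 + B1.aSeq a ((ℓ : ℝ) + 1) k * (ℓ₁ * τ * (2 + ℓ₁ * τ))) ≤ 1 / 2 →
        ∀ Φ : ↥(Box d ℓ k M) × ι → ℝ,
          supN (greenA d F κ ℓ k a m2 M emb Γ (constBond A₀ Subtype.val + A') *ᵥ Φ)
              + ∑ μ, supN (derivA0 d F κ ℓ k M A₀ μ
                  *ᵥ (greenA d F κ ℓ k a m2 M emb Γ (constBond A₀ Subtype.val + A') *ᵥ Φ))
              ≤ 2 * (((d : ℝ) + 2) * c) * supN Φ ∧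
          ∀ μ : Fin (d + 1),
            supN (derivA d F κ ℓ k M (constBond A₀ Subtype.val + A') μ
                *ᵥ (greenA d F κ ℓ k a m2 M emb Γ (constBond A₀ Subtype.val + A') *ᵥ Φ))
              ≤ (1 + ℓ₁ * θ) * (2 * (((d : ℝ) + 2) * c)) * supN Φ := by
  obtain ⟨c, hc, h⟩ := lemma22_17_sup_cross F hℓ₁ hLip κ d ℓ hℓ amin aplus m2plus ha
  refine ⟨c, hc, ?_⟩
  intro k hk a m2 e1' e2 e3 e4 M hM emb Γ hend A₀ A' θ θ' θf τ hunit hθ hA' hθ' hder hθf hface hτ0 hτ hsm Φ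
  have hn : 1 ≤ (ℓ + 1) ^ k := Nat.one_le_pow _ _ (Nat.succ_pos ℓ)
  have hC := firstOrderSmall_cross_face F hℓ₁ hLip κ hn (fun i => (ℓ + 1) ^ k * M i) (constBond A₀ Subtype.val)
    (constBond_antisymm A₀ Subtype.val) hθ hA' hθ' hθf hder hface
  exact h k hk a m2 e1' e2 e3 e4 M hM emb Γ hend A₀ A' _ θ τ hunit hθ hA' hτ0 hτ hC hsm Φ

/-- **LEMMA 2.2 (2.17), `q = p = ∞`, `n = 0,1`, FOR `G_k(□,Ã)` ON A FINE BOX WITH THE STAIRCASE CONTOURS, FACE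
VERSION** — invertibility and contour hypotheses discharged as in `B4Lemma22SupStair.lemma22_17_sup_stair`:
for all `k ≥ 1`, the window, all boxes, all constant `A₀` and all `A'` with `|κA'_b| ≤ θ/n` on nearest-neighbour
bonds, `|κ(A'(b') − A'(b))| ≤ θ'/n²` on consecutive parallel bonds, `|κA'_b| ≤ θ_f/n²` on the `μ`-bonds touching
the `μ`-faces, and the two smallness conditions `ℓ²θ²(d+1)(1 + a_k(d+1)) ≤ min(2,a_k)/4`,
`(d+2)c((d+1)ℓ(θ+(θ'+θ_f)) + (d+1)ℓθ + (d+1)ℓ²θ² + a_kℓ(d+1)θ(2 + ℓ(d+1)θ)) ≤ 1/2`: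
`‖GΦ‖_∞ + Σ_μ‖D^η_{A₀,μ}GΦ‖_∞ ≤ 2(d+2)c‖Φ‖_∞` and `‖D^η_{Ã,μ}GΦ‖_∞ ≤ (1+ℓθ)·2(d+2)c‖Φ‖_∞`.
[cite: Balaban1983RegularityDecay, Lemma 2.2 (2.17) p. 578; proof pp. 579–582] -/
theorem lemma22_17_sup_stair_face (F : OrthFlow ι) {ℓ₁ : ℝ} (hℓ₁ : 0 ≤ ℓ₁)
    (hLip : ∀ t (v : ι → ℝ), ((F.U t - 1) *ᵥ v) ⬝ᵥ ((F.U t - 1) *ᵥ v) ≤ (ℓ₁ * t) ^ 2 * (v ⬝ᵥ v))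
    (κ : ℝ) (d ℓ : ℕ) (hℓ : 1 ≤ ℓ) (amin aplus m2plus : ℝ) (ha : 0 < amin) :
    ∃ c : ℝ, 0 < c ∧ ∀ (k : ℕ), 1 ≤ k → ∀ (hn : 1 ≤ (ℓ + 1) ^ k) (a m2 : ℝ),
      amin ≤ a → a ≤ aplus → 0 ≤ m2 → m2 ≤ m2plus →
      ∀ (M : Fin (d + 1) → ℕ), (∀ i, 1 ≤ M i) →
      ∀ (A₀ : Fin (d + 1) → ℝ) (A' : ↥(Box d ℓ k M) → ↥(Box d ℓ k M) → ℝ) (θ θ' θf : ℝ),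
        0 ≤ θ → (∀ x y : ↥(Box d ℓ k M), y.1 ∈ nbrs x.1 → |κ * A' x y| ≤ θ / ((ℓ + 1) ^ k : ℕ)) →
        0 ≤ θ' → (∀ (x z y : ↥(Box d ℓ k M)) (μ : Fin (d + 1)), z.1 = x.1 + e1 μ → y.1 = z.1 + e1 μ →
          |κ * (A' y z - A' z x)| ≤ θ' / (((ℓ + 1) ^ k : ℕ) : ℝ) ^ 2 ∧
          |κ * (A' x z - A' z y)| ≤ θ' / (((ℓ + 1) ^ k : ℕ) : ℝ) ^ 2) →
        0 ≤ θf → (∀ (x y : ↥(Box d ℓ k M)) (μ : Fin (d + 1)), y.1 = x.1 + e1 μ →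
          (x.1 - e1 μ ∉ Box d ℓ k M ∨ y.1 + e1 μ ∉ Box d ℓ k M) →
          |κ * A' x y| ≤ θf / (((ℓ + 1) ^ k : ℕ) : ℝ) ^ 2 ∧ |κ * A' y x| ≤ θf / (((ℓ + 1) ^ k : ℕ) : ℝ) ^ 2) →
        ℓ₁ ^ 2 * θ ^ 2 * ((d : ℝ) + 1) * (1 + B1.aSeq a ((ℓ : ℝ) + 1) k * ((d : ℝ) + 1))
          ≤ min 2 (B1.aSeq a ((ℓ : ℝ) + 1) k) / 4 →
        ((d : ℝ) + 2) * c * (((d : ℝ) + 1) * ℓ₁ * (θ + (θ' + θf)) + ((d : ℝ) + 1) * ℓ₁ * θ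
          + ((d : ℝ) + 1) * ℓ₁ ^ 2 * θ ^ 2
          + B1.aSeq a ((ℓ : ℝ) + 1) k * (ℓ₁ * (((d : ℝ) + 1) * θ) * (2 + ℓ₁ * (((d : ℝ) + 1) * θ)))) ≤ 1 / 2 →
        ∀ Φ : ↥(Box d ℓ k M) × ι → ℝ,
          supN (greenA d F κ ℓ k a m2 M (baseEmb hn M) (stairContour hn M) (constBond A₀ Subtype.val + A') *ᵥ Φ)
              + ∑ μ, supN (derivA0 d F κ ℓ k M A₀ μ
                  *ᵥ (greenA d F κ ℓ k a m2 M (baseEmb hn M) (stairContour hn M) (constBond A₀ Subtype.val + A')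
                      *ᵥ Φ))
              ≤ 2 * (((d : ℝ) + 2) * c) * supN Φ ∧
          ∀ μ : Fin (d + 1),
            supN (derivA d F κ ℓ k M (constBond A₀ Subtype.val + A') μ
                *ᵥ (greenA d F κ ℓ k a m2 M (baseEmb hn M) (stairContour hn M) (constBond A₀ Subtype.val + A')
                    *ᵥ Φ))
              ≤ (1 + ℓ₁ * θ) * (2 * (((d : ℝ) + 2) * c)) * supN Φ := by
  obtain ⟨c, hc, h⟩ := lemma22_17_sup_box_face F hℓ₁ hLip κ d ℓ hℓ amin aplus m2plus ha
  refine ⟨c, hc, ?_⟩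
  intro k hk hn a m2 e1' e2 e3 e4 M hM A₀ A' θ θ' θf hθ hA' hθ' hder hθf hface hsm2 hsm Φ
  have hL : (1 : ℝ) < (ℓ : ℝ) + 1 := by
    have : (1 : ℝ) ≤ ℓ := by exact_mod_cast hℓ
    linarith
  have hak : 0 < B1.aSeq a ((ℓ : ℝ) + 1) k := B1.aSeq_pos (lt_of_lt_of_le ha e1') hL hk
  have hpos : 0 < min 2 (B1.aSeq a ((ℓ : ℝ) + 1) k) / 4 + m2 := by
    have : 0 < min 2 (B1.aSeq a ((ℓ : ℝ) + 1) k) := lt_min two_pos hak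
    linarith
  have hAd : ∀ x y : ↥(Box d ℓ k M), y.1 ∈ nbrs x.1 →
      |κ * ((constBond A₀ Subtype.val + A' : ↥(Box d ℓ k M) → ↥(Box d ℓ k M) → ℝ) x y
        - constBond A₀ Subtype.val x y)| ≤ θ / ((ℓ + 1) ^ k : ℕ) := by
    intro x y hxy
    simpa only [Pi.add_apply, add_sub_cancel_left] using hA' x y hxy
  have hunit := (green_box_l2_bound F hℓ₁ hLip κ hn hak.le hpos M A₀ (A := constBond A₀ Subtype.val + A') hθ hAd
    hsm2 0).1
  have hτ : ∀ y x, blkWt ((ℓ + 1) ^ k) M (fun i => (ℓ + 1) ^ k * M i) y x ≠ 0 →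
      |κ * lsum A' (baseEmb hn M y) (stairContour hn M y x)| ≤ ((d : ℝ) + 1) * θ :=
    fun y x _ => stair_lsum_le κ hn M hθ hA' y x
  have hτ0 : 0 ≤ ((d : ℝ) + 1) * θ := by positivity
  exact h k hk a m2 e1' e2 e3 e4 M hM (baseEmb hn M) (stairContour hn M) (fun y x hw => stairContour_end hn M y x hw)
    A₀ A' θ θ' θf (((d : ℝ) + 1) * θ) hunit hθ hA' hθ' hder hθf hface hτ0 hτ hsm Φ

end Face

/-! ## §2. The Neumann-gauged field as a bond function on the fine box: size, derivative and face bounds -/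

section GaugedBond

variable {d : ℕ}

/-- `e·e^{β−1} = e^β`. [cite: Balaban1983RegularityDecay, (1.7) p. 572, dictionary] -/
private theorem mul_rpow_sub_one {e : ℝ} (he : 0 < e) (β : ℝ) : e * e ^ (β - 1) = e ^ β := by
  rw [Real.rpow_sub_one he.ne', mul_div_cancel₀ _ he.ne']

/-- `C₁(d) ≥ 0`. [cite: Balaban1983RegularityDecay, (1.7) p. 572, dictionary] -/
private theorem C1_nonneg (d : ℕ) : 0 ≤ C1 d := by unfold C1; positivity

/-- `C₂(d) ≥ 0`. [cite: Balaban1983RegularityDecay, (1.7) p. 572, dictionary] -/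
private theorem C2_nonneg (d : ℕ) : 0 ≤ C2 d := by unfold C2; positivity

/-- a site of the box whose lower `μ`-neighbour is outside sits on the lower `μ`-face. [cite: Balaban1983RegularityDecay, p. 584 «□ = {x ∈ ξZ^d : 0 ≤ x_μ ≤ M_μ}», dictionary] -/
private theorem coord_zero_of_not_mem {N : Fin (d + 1) → ℕ} {x : Fin (d + 1) → ℤ} (hx : x ∈ boxDom N)
    {μ : Fin (d + 1)} (h : x - e1 μ ∉ boxDom N) : x μ = 0 := by
  rw [mem_boxDom] at hx
  by_contra hne
  apply h
  rw [mem_boxDom]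
  intro i
  by_cases hi : i = μ
  · rw [hi]
    have := hx μ
    simp only [Pi.sub_apply, e1_apply_self]
    omega
  · simp only [Pi.sub_apply, e1_apply_ne hi, sub_zero]
    exact hx i

/-- a site of the box whose upper `μ`-neighbour is outside sits on the upper `μ`-face. [cite: Balaban1983RegularityDecay, p. 584 «□ = {x ∈ ξZ^d : 0 ≤ x_μ ≤ M_μ}», dictionary] -/
private theorem coord_top_of_not_mem {N : Fin (d + 1) → ℕ} {y : Fin (d + 1) → ℤ} (hy : y ∈ boxDom N)
    {μ : Fin (d + 1)} (h : y + e1 μ ∉ boxDom N) : y μ = (N μ : ℤ) - 1 := by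
  rw [mem_boxDom] at hy
  by_contra hne
  apply h
  rw [mem_boxDom]
  intro i
  by_cases hi : i = μ
  · rw [hi]
    have := hy μ
    simp only [Pi.add_apply, e1_apply_self]
    omega
  · simp only [Pi.add_apply, e1_apply_ne hi, add_zero]
    exact hy i

/-- **WALKING IN FROM THE FACE ALONG THE NORMAL LINE**: for a field `(1.7)`-regular (`κ`) on the fine box
`Π[0,N_μ)` (`N_μ ≥ 3`), the Neumann-gauged field `A'' = A + dλ` of `B4BoxNeumannGauge` has
`|A''_ν(x)| ≤ (C₂(d) + x_ν·C₁(d))κ` on every `ν`-bond `(x, x+e_ν)` of the box: `|A''_ν| ≤ C₂κ` on the first normal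
layer (`gauged_face_lo`) and each step along `e_ν` costs `C₁κ` (`gauged_regular` in the direction of the bond).
[cite: Balaban1983RegularityDecay, (1.7) p. 572; p. 579 (2.23) «|A′|, |∂^η_μA′| ≤ c′e^{β−1}»] -/
theorem gauged_abs_le_of_coord {N : Fin (d + 1) → ℕ} (hN : ∀ μ, 3 ≤ N μ)
    {Ac : (Fin (d + 1) → ℤ) → Fin (d + 1) → ℝ} {κ : ℝ}
    (hreg : ∀ x ∈ boxDom N, ∀ i ν : Fin (d + 1), |Ac (x + e1 i) ν - Ac x ν| ≤ κ) (ν : Fin (d + 1)) :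
    ∀ (t : ℕ) (x : Fin (d + 1) → ℤ), x ∈ boxDom N → x ν = t → x + e1 ν ∈ boxDom N →
      |gauged N Ac x ν| ≤ (C2 d + t * C1 d) * κ := by
  intro t
  induction t with
  | zero =>
    intro x hx hxν _
    have h := gauged_face_lo hN hreg hx (μ := ν) (by exact_mod_cast hxν)
    simpa using h
  | succ t ih =>
    intro x hx hxν hxe
    have hxc := (mem_boxDom.1 hx) ν
    have hx' : x - e1 ν ∈ boxDom N := by
      rw [mem_boxDom]
      intro i
      by_cases hi : i = ν
      · rw [hi]
        simp only [Pi.sub_apply, e1_apply_self]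
        omega
      · simp only [Pi.sub_apply, e1_apply_ne hi, sub_zero]
        exact (mem_boxDom.1 hx) i
    have hx'ν : (x - e1 ν) ν = (t : ℤ) := by
      simp only [Pi.sub_apply, e1_apply_self]
      omega
    have h1 : x - e1 ν + e1 ν = x := sub_add_cancel _ _
    have ih' := ih (x - e1 ν) hx' hx'ν (by rw [h1]; exact hx)
    have hreg' := gauged_regular hN hreg (x := x - e1 ν) (i := ν) (ν := ν) hx' (by rw [h1]; exact hx)
      (by rw [h1]; exact hx) (by rw [h1]; exact hxe)
    rw [h1] at hreg'
    have htri := abs_sub_abs_le_abs_sub (gauged N Ac x ν) (gauged N Ac (x - e1 ν) ν)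
    have e : (C2 d + ((t + 1 : ℕ) : ℝ) * C1 d) * κ = (C2 d + (t : ℝ) * C1 d) * κ + C1 d * κ := by
      push_cast; ring
    rw [e]
    linarith

/-- **THE SUP SIZE OF THE NEUMANN-GAUGED FIELD**: `|A''_ν(x)| ≤ (C₂(d) + N_ν·C₁(d))κ` on every `ν`-bond of the
fine box `Π[0,N_μ)` (`κ ≥ 0`) — no collar, no log of the box size.
[cite: Balaban1983RegularityDecay, (1.7) p. 572; p. 579 (2.23) «|A′| … ≤ c′e^{β−1}», p. 575 «c′ = dMc»] -/
theorem gauged_abs_le {N : Fin (d + 1) → ℕ} (hN : ∀ μ, 3 ≤ N μ)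
    {Ac : (Fin (d + 1) → ℤ) → Fin (d + 1) → ℝ} {κ : ℝ} (hκ : 0 ≤ κ)
    (hreg : ∀ x ∈ boxDom N, ∀ i ν : Fin (d + 1), |Ac (x + e1 i) ν - Ac x ν| ≤ κ)
    {x : Fin (d + 1) → ℤ} (hx : x ∈ boxDom N) {ν : Fin (d + 1)} (hxe : x + e1 ν ∈ boxDom N) :
    |gauged N Ac x ν| ≤ (C2 d + (N ν : ℝ) * C1 d) * κ := by
  have hxν := (mem_boxDom.1 hx) ν
  obtain ⟨t, ht⟩ : ∃ t : ℕ, x ν = t := ⟨(x ν).toNat, (Int.toNat_of_nonneg hxν.1).symm⟩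
  have h := gauged_abs_le_of_coord hN hreg ν t x hx ht hxe
  have htN : (t : ℝ) ≤ N ν := by
    have h2 : (t : ℤ) < N ν := ht ▸ hxν.2
    exact_mod_cast h2.le
  refine h.trans (mul_le_mul_of_nonneg_right ?_ hκ)
  have := mul_le_mul_of_nonneg_right htN (C1_nonneg d)
  linarith

/-- **THE CHARGE-SCALED GAUGE FUNCTION `κλ`** of the discrete Neumann gauge (`B4BoxNeumannGauge.gaugeFn`) on the
sites of the fine box. [cite: Balaban1983RegularityDecay, pp. 580–581 (gauge transformations), dictionary] -/
def gSig (κ : ℝ) (N : Fin (d + 1) → ℕ) (Ac : (Fin (d + 1) → ℤ) → Fin (d + 1) → ℝ) : ↥(boxDom N) → ℝ :=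
  fun w => κ * gaugeFn N Ac w.1

/-- **THE GAUGED FIELD `κA'' = κ(A + dλ)` AS A BOND FUNCTION ON THE FINE BOX**: the lineage's
`bondGauge (−κλ) (κA)`; on the bonds `(u, u ± e_ν)` it is `±κA''_ν` (`gBond_step`, `gBond_step_rev`).
[cite: Balaban1983RegularityDecay, pp. 580–581 (gauge transformations), p. 581 «Ã = A₀ + A'», dictionary] -/
def gBond (κ : ℝ) (N : Fin (d + 1) → ℕ) (Ac : (Fin (d + 1) → ℤ) → Fin (d + 1) → ℝ) :
    ↥(boxDom N) → ↥(boxDom N) → ℝ :=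
  bondGauge (fun w => -gSig κ N Ac w) (fun u v => κ * compField Ac u.1 v.1)

/-- **`κA = (κA'')^{κλ}` EXACTLY** (as bond functions on all pairs): gauging back recovers the field.
[cite: Balaban1983RegularityDecay, pp. 580–581 (gauge transformations), dictionary] -/
theorem bondGauge_gBond (κ : ℝ) (N : Fin (d + 1) → ℕ) (Ac : (Fin (d + 1) → ℤ) → Fin (d + 1) → ℝ) :
    bondGauge (gSig κ N Ac) (gBond κ N Ac) = fun u v : ↥(boxDom N) => κ * compField Ac u.1 v.1 := by
  funext u v
  simp only [gBond, bondGauge]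
  ring

/-- on the bond `(u, u + e_ν)`: `κA''_ν(u)`. [cite: Balaban1983RegularityDecay, p. 572 «A_{⟨x,x+ηe_μ⟩} = A_μ(x)», dictionary] -/
theorem gBond_step {κ : ℝ} {N : Fin (d + 1) → ℕ} {Ac : (Fin (d + 1) → ℤ) → Fin (d + 1) → ℝ}
    {u v : ↥(boxDom N)} {ν : Fin (d + 1)} (h : v.1 = u.1 + e1 ν) :
    gBond κ N Ac u v = κ * gauged N Ac u.1 ν := by
  simp only [gBond, bondGauge, gSig, h, compField_add, gauged]
  ring

/-- on the reversed bond `(v + e_ν, v)`: `−κA''_ν(v)`. [cite: Balaban1983RegularityDecay, p. 576 «A_b̄ = −A_b», dictionary] -/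
theorem gBond_step_rev {κ : ℝ} {N : Fin (d + 1) → ℕ} {Ac : (Fin (d + 1) → ℤ) → Fin (d + 1) → ℝ}
    {u v : ↥(boxDom N)} {ν : Fin (d + 1)} (h : u.1 = v.1 + e1 ν) :
    gBond κ N Ac u v = -(κ * gauged N Ac v.1 ν) := by
  simp only [gBond, bondGauge, gSig, h, compField_sub, gauged]
  ring

/-- the component bond function is antisymmetric. [cite: Balaban1983RegularityDecay, p. 576 «A_b̄ = −A_b», dictionary] -/
private theorem compField_antisymm (Ac : (Fin (d + 1) → ℤ) → Fin (d + 1) → ℝ) (x y : Fin (d + 1) → ℤ) :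
    compField Ac y x = -compField Ac x y := by
  unfold compField
  ring

/-- `κA''` is antisymmetric. [cite: Balaban1983RegularityDecay, p. 576 «A_b̄ = −A_b», dictionary] -/
theorem gBond_antisymm {κ : ℝ} {N : Fin (d + 1) → ℕ} {Ac : (Fin (d + 1) → ℤ) → Fin (d + 1) → ℝ}
    (u v : ↥(boxDom N)) : gBond κ N Ac v u = -gBond κ N Ac u v := by
  simp only [gBond, bondGauge]
  rw [compField_antisymm Ac u.1 v.1]
  ring

/-- **THE FIELD HYPOTHESES OF THE LEMMA-2.2 LINEAGE FOR THE GAUGED FIELD, FROM (1.7) WITH NO COLLAR.**  Fine box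
`Π_μ[0, nM_μ)` (`M_μ ≤ S`, `nM_μ ≥ 3`), `A` regular on it in the printed sense (1.7) with constants `c, β`, charge
`e > 0`, coupling `e/n`; `A' := (e/n)A''` (`gBond`).  Then `A'` is antisymmetric, `|A'_b| ≤ θ/n` on
nearest-neighbour bonds with `θ = (C₂(d) + S·C₁(d))ce^β`, `|A'(b') − A'(b)| ≤ θ'/n²` on consecutive parallel bonds
with `θ' = C₁(d)ce^β`, and `|A'_b| ≤ θ_f/n²` (both orientations) on the `μ`-bonds touching the `μ`-faces with
`θ_f = C₂(d)ce^β` — the hypotheses `hA'/hder/hface` of §1 at coupling `1`.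
[cite: Balaban1983RegularityDecay, (1.7) p. 572; p. 579 (2.23); p. 581 (2.32)] -/
theorem gBond_hyps {n : ℕ} (hn : 1 ≤ n) {M : Fin (d + 1) → ℕ} {S : ℕ} (hS : ∀ i, M i ≤ S)
    (hN3 : ∀ i, 3 ≤ n * M i) {Ac : (Fin (d + 1) → ℤ) → Fin (d + 1) → ℝ} {creg β e : ℝ}
    (hcreg : 0 ≤ creg) (he : 0 < e)
    (h17 : ∀ x ∈ boxDom (fun i => n * M i), ∀ μ ν : Fin (d + 1),
      |Ac (x + e1 μ) ν - Ac x ν| ≤ creg * e ^ (β - 1) / n) :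
    (∀ x y, gBond (e / n) (fun i => n * M i) Ac y x = -gBond (e / n) (fun i => n * M i) Ac x y) ∧
    (∀ x y : ↥(boxDom fun i => n * M i), y.1 ∈ nbrs x.1 →
      |1 * gBond (e / n) (fun i => n * M i) Ac x y| ≤ (C2 d + S * C1 d) * creg * e ^ β / n) ∧
    (∀ (x z y : ↥(boxDom fun i => n * M i)) (μ : Fin (d + 1)), z.1 = x.1 + e1 μ → y.1 = z.1 + e1 μ →
      |1 * (gBond (e / n) (fun i => n * M i) Ac y z - gBond (e / n) (fun i => n * M i) Ac z x)|
          ≤ C1 d * creg * e ^ β / (n : ℝ) ^ 2 ∧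
      |1 * (gBond (e / n) (fun i => n * M i) Ac x z - gBond (e / n) (fun i => n * M i) Ac z y)|
          ≤ C1 d * creg * e ^ β / (n : ℝ) ^ 2) ∧
    (∀ (x y : ↥(boxDom fun i => n * M i)) (μ : Fin (d + 1)), y.1 = x.1 + e1 μ →
      (x.1 - e1 μ ∉ boxDom (fun i => n * M i) ∨ y.1 + e1 μ ∉ boxDom (fun i => n * M i)) →
      |1 * gBond (e / n) (fun i => n * M i) Ac x y| ≤ C2 d * creg * e ^ β / (n : ℝ) ^ 2 ∧
      |1 * gBond (e / n) (fun i => n * M i) Ac y x| ≤ C2 d * creg * e ^ β / (n : ℝ) ^ 2) := by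
  set N : Fin (d + 1) → ℕ := fun i => n * M i with hN_def
  have hN3' : ∀ μ, 3 ≤ N μ := hN3
  have hnr : (0 : ℝ) < n := by exact_mod_cast hn
  have hn1 : (1 : ℝ) ≤ n := by exact_mod_cast hn
  have hpow : 0 < e ^ β := Real.rpow_pos_of_pos he β
  have hpow1 : 0 < e ^ (β - 1) := Real.rpow_pos_of_pos he (β - 1)
  set κr : ℝ := creg * e ^ (β - 1) / n with hκr
  have hκr0 : 0 ≤ κr := by positivity
  have hen : 0 < e / n := div_pos he hnr
  have hkey : e / n * κr = creg * e ^ β / (n : ℝ) ^ 2 := by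
    rw [hκr, ← mul_rpow_sub_one he β]
    field_simp
  have hC1 := C1_nonneg d
  have hC2 := C2_nonneg d
  -- the sup size on a `μ`-bond `(x, x + e_μ)` of the box
  have hsize : ∀ (x : ↥(boxDom N)) (μ : Fin (d + 1)), x.1 + e1 μ ∈ boxDom N →
      e / n * |gauged N Ac x.1 μ| ≤ (C2 d + S * C1 d) * creg * e ^ β / n := by
    intro x μ hxe
    have hb := gauged_abs_le hN3' hκr0 h17 x.2 hxe
    have hcoef : C2 d + (N μ : ℝ) * C1 d ≤ (n : ℝ) * (C2 d + S * C1 d) := by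
      have hNμ : (N μ : ℝ) ≤ (n : ℝ) * S := by
        have : N μ ≤ n * S := Nat.mul_le_mul_left _ (hS μ)
        exact_mod_cast this
      nlinarith [mul_le_mul_of_nonneg_right hNμ hC1]
    calc e / n * |gauged N Ac x.1 μ| ≤ e / n * ((C2 d + (N μ : ℝ) * C1 d) * κr) :=
          mul_le_mul_of_nonneg_left hb hen.le
      _ = (C2 d + (N μ : ℝ) * C1 d) * (creg * e ^ β / (n : ℝ) ^ 2) := by rw [← hkey]; ring
      _ ≤ (n : ℝ) * (C2 d + S * C1 d) * (creg * e ^ β / (n : ℝ) ^ 2) :=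
          mul_le_mul_of_nonneg_right hcoef (by positivity)
      _ = (C2 d + S * C1 d) * creg * e ^ β / n := by field_simp
  refine ⟨fun x y => gBond_antisymm x y, fun x y hxy => ?_, fun x z y μ hz hy => ?_, fun x y μ hy hface => ?_⟩
  · -- the bond size
    obtain ⟨μ, h | h⟩ := mem_nbrs.1 hxy
    · have h' : y.1 = x.1 + e1 μ := h
      rw [one_mul, gBond_step h', abs_mul, abs_of_pos hen]
      exact hsize x μ (h' ▸ y.2)
    · have h' : x.1 = y.1 + e1 μ := by rw [h, e1, sub_add_cancel]
      rw [one_mul, gBond_step_rev h', abs_neg, abs_mul, abs_of_pos hen]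
      exact hsize y μ (h' ▸ x.2)
  · -- the derivative member: both quantities are `(e/n)|A''_μ(x + e_μ) − A''_μ(x)|`
    have hxe : x.1 + e1 μ ∈ boxDom N := hz ▸ z.2
    have hxee : x.1 + e1 μ + e1 μ ∈ boxDom N := by rw [← hz, ← hy]; exact y.2
    have hreg := gauged_regular hN3' h17 (x := x.1) (i := μ) (ν := μ) x.2 hxe hxe hxee
    rw [← hz] at hreg
    have key : e / n * |gauged N Ac z.1 μ - gauged N Ac x.1 μ| ≤ C1 d * creg * e ^ β / (n : ℝ) ^ 2 := by
      calc e / n * |gauged N Ac z.1 μ - gauged N Ac x.1 μ| ≤ e / n * (C1 d * κr) :=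
            mul_le_mul_of_nonneg_left hreg hen.le
        _ = C1 d * (e / n * κr) := by ring
        _ = C1 d * creg * e ^ β / (n : ℝ) ^ 2 := by rw [hkey]; ring
    constructor
    · rw [one_mul, gBond_step_rev hy, gBond_step_rev hz, show -(e / ↑n * gauged N Ac z.1 μ)
        - -(e / ↑n * gauged N Ac x.1 μ) = -(e / n * (gauged N Ac z.1 μ - gauged N Ac x.1 μ)) by ring,
        abs_neg, abs_mul, abs_of_pos hen]
      exact key
    · rw [one_mul, gBond_step hz, gBond_step hy, ← mul_sub, abs_mul, abs_of_pos hen, abs_sub_comm]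
      exact key
  · -- the face bonds
    have hxe : x.1 + e1 μ ∈ boxDom N := hy ▸ y.2
    have hb : |gauged N Ac x.1 μ| ≤ C2 d * κr := by
      rcases hface with h | h
      · exact gauged_face_lo hN3' h17 x.2 (coord_zero_of_not_mem x.2 h)
      · refine gauged_face_hi hN3' h17 x.2 ?_
        have htop := coord_top_of_not_mem y.2 h
        have := congrFun hy μ
        simp only [Pi.add_apply, e1_apply_self] at this
        omega
    have key : e / n * |gauged N Ac x.1 μ| ≤ C2 d * creg * e ^ β / (n : ℝ) ^ 2 := by
      calc e / n * |gauged N Ac x.1 μ| ≤ e / n * (C2 d * κr) := mul_le_mul_of_nonneg_left hb hen.le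
        _ = C2 d * (e / n * κr) := by ring
        _ = C2 d * creg * e ^ β / (n : ℝ) ^ 2 := by rw [hkey]; ring
    constructor
    · rw [one_mul, gBond_step hy, abs_mul, abs_of_pos hen]
      exact key
    · rw [one_mul, gBond_step_rev hy, abs_neg, abs_mul, abs_of_pos hen]
      exact key

/-- **«FOR e SUFFICIENTLY SMALL», NO-COLLAR VERSION** — the common threshold of §3–§4 (for the Lemma-2.2 constant
`c` of the member at hand): for `0 < e ≤ e₁`, `θ(e) = (C₂(d) + S·C₁(d))·c·e^β ≤ 1` and both smallness conditions of
the lineage hold at `θ(e)` and `θ'(e) + θ_f(e) = C₁(d)ce^β + C₂(d)ce^β`, for every `a_k` of the window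
`[¾a₋, a₊]`. [cite: Balaban1983RegularityDecay, Theorem p. 573 «for e sufficiently small», p. 581] -/
theorem noCollar_threshold (d : ℕ) {ℓ₁ c amin aplus creg β : ℝ} (hℓ₁ : 0 ≤ ℓ₁) (hc : 0 ≤ c)
    (ha : 0 < amin) (hcreg : 0 ≤ creg) (hβ : 0 < β) (S : ℕ) :
    ∃ e₁ : ℝ, 0 < e₁ ∧ ∀ e : ℝ, 0 < e → e ≤ e₁ → ∀ ak : ℝ, 3 / 4 * amin ≤ ak → ak ≤ aplus →
      (C2 d + S * C1 d) * creg * e ^ β ≤ 1 ∧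
      ℓ₁ ^ 2 * ((C2 d + S * C1 d) * creg * e ^ β) ^ 2 * ((d : ℝ) + 1) * (1 + ak * ((d : ℝ) + 1))
        ≤ min 2 ak / 4 ∧
      ((d : ℝ) + 2) * c * (((d : ℝ) + 1) * ℓ₁ * ((C2 d + S * C1 d) * creg * e ^ β
          + (C1 d * creg * e ^ β + C2 d * creg * e ^ β))
        + ((d : ℝ) + 1) * ℓ₁ * ((C2 d + S * C1 d) * creg * e ^ β)
        + ((d : ℝ) + 1) * ℓ₁ ^ 2 * ((C2 d + S * C1 d) * creg * e ^ β) ^ 2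
        + ak * (ℓ₁ * (((d : ℝ) + 1) * ((C2 d + S * C1 d) * creg * e ^ β))
          * (2 + ℓ₁ * (((d : ℝ) + 1) * ((C2 d + S * C1 d) * creg * e ^ β))))) ≤ 1 / 2 := by
  have hC1 := C1_nonneg d
  have hC2 := C2_nonneg d
  set t : ℝ := min 1 (min (min 2 (3 / 4 * amin) / 4 / (ℓ₁ ^ 2 * ((d : ℝ) + 1) * (1 + aplus * ((d : ℝ) + 1)) + 1))
    (1 / (2 * (((d : ℝ) + 2) * c) * (3 * ((d : ℝ) + 1) * ℓ₁ + ((d : ℝ) + 1) * ℓ₁ ^ 2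
      + aplus * (ℓ₁ * ((d : ℝ) + 1)) * (2 + ℓ₁ * ((d : ℝ) + 1))) + 1))) with ht_def
  by_cases hapl : aplus < 3 / 4 * amin
  · refine ⟨1, one_pos, fun e _ _ ak hak1 hak2 => absurd (hak1.trans hak2) (not_le.2 hapl)⟩
  rw [not_lt] at hapl
  have hapl0 : 0 ≤ aplus := by linarith
  have ht0 : 0 < t := by
    rw [ht_def]
    refine lt_min one_pos (lt_min ?_ ?_)
    · exact div_pos (div_pos (lt_min two_pos (by linarith)) four_pos) (by positivity)
    · exact div_pos one_pos (by positivity)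
  obtain ⟨e₁, he₁, hth⟩ := cube_threshold (C := (C2 d + S * C1 d) * creg) (C' := (C1 d + C2 d) * creg)
    (by positivity) ht0 hβ
  refine ⟨e₁, he₁, fun e he hle ak hak1 hak2 => ?_⟩
  obtain ⟨hθt, hθ't⟩ := hth e he hle
  have hθ0 : 0 ≤ (C2 d + S * C1 d) * creg * e ^ β := by
    have := (Real.rpow_pos_of_pos he β).le; positivity
  have ht1 : t ≤ 1 := by rw [ht_def]; exact min_le_left _ _
  have htS1 : t ≤ min 2 (3 / 4 * amin) / 4 / (ℓ₁ ^ 2 * ((d : ℝ) + 1) * (1 + aplus * ((d : ℝ) + 1)) + 1) := by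
    rw [ht_def]; exact (min_le_right _ _).trans (min_le_left _ _)
  have htS2 : t ≤ 1 / (2 * (((d : ℝ) + 2) * c) * (3 * ((d : ℝ) + 1) * ℓ₁ + ((d : ℝ) + 1) * ℓ₁ ^ 2
      + aplus * (ℓ₁ * ((d : ℝ) + 1)) * (2 + ℓ₁ * ((d : ℝ) + 1))) + 1) := by
    rw [ht_def]; exact (min_le_right _ _).trans (min_le_right _ _)
  have hθ'le : C1 d * creg * e ^ β + C2 d * creg * e ^ β ≤ t := by
    calc C1 d * creg * e ^ β + C2 d * creg * e ^ β = (C1 d + C2 d) * creg * e ^ β := by ring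
      _ ≤ t := hθ't
  exact ⟨hθt.trans ht1, smallness_of_le d hℓ₁ hc ha hak1 hak2 hθ0 hθt hθ'le ht1 htS1 htS2⟩

end GaugedBond

/-! ## §3. LEMMA 2.2 (2.17), sup members, for `G_k(□, A)` at a (1.7)-regular `A` with NO collar -/

section NoCollar

variable {d : ℕ}

/-- the zero constant configuration is the zero bond function. [cite: Balaban1983RegularityDecay, p. 581 «constant configurations A₀», dictionary] -/
private theorem constBond_zero {X : Type*} (pos : X → (Fin (d + 1) → ℤ)) :
    constBond (0 : Fin (d + 1) → ℝ) pos = 0 := by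
  funext u v
  simp [constBond]

/-- **LEMMA 2.2 (2.17), SUP MEMBERS `n = 0, 1`, FOR `G_k(□, A)` AT THE FIELD `A` ITSELF, (1.7)-REGULAR ON THE BOX,
WITH NO COLLAR** (the print's boundary-cube choice «Ã_j = A», p. 575, on a parallelepiped, p. 579): there is `C > 0`
(from Lemma 2.2 at charge `1`: `d`, `N`, the flow, `L`, the windows) such that for every regularity pair `(c, β)`,
`β > 0`, and side bound `S` there is `e₁ > 0` with: for every mesh `n = L^k`, `k ≥ 1`, every `a, m²` of the windows,
every box `□ = Π_μ[0, nM_μ)` with `1 ≤ M_μ ≤ S` and `nM_μ ≥ 3`, EVERY component field `A` with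
`|A_ν(x + e_μ) − A_ν(x)| ≤ ce^{β−1}/n` for `x ∈ □` (the printed (1.7), nothing at the boundary) and every charge
`0 < e ≤ e₁`: `‖G_k(□,A)Φ‖_∞ ≤ C‖Φ‖_∞` and `‖D^η_{A,μ}G_k(□,A)Φ‖_∞ ≤ C‖Φ‖_∞` for every `μ` (coupling `e/n`,
corner embedding, staircase contours).  Proof: §1 at `A₀ = 0`, `A' = (e/n)A''` (§2), then the gauge step
`A = (A'')^λ` (`b4Green_bondGauge`, `covDeriv_gauge`, `sup_hyps_conj`).
[cite: Balaban1983RegularityDecay, Lemma 2.2 (2.17) p. 578 with p. 579 «we can apply Lemma 2.2 to all operators in it» and (1.7) p. 572] -/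
theorem lemma22_sup_noCollar (F : OrthFlow ι) {ℓ₁ : ℝ} (hℓ₁ : 0 ≤ ℓ₁)
    (hLip : ∀ t (v : ι → ℝ), ((F.U t - 1) *ᵥ v) ⬝ᵥ ((F.U t - 1) *ᵥ v) ≤ (ℓ₁ * t) ^ 2 * (v ⬝ᵥ v))
    (d ℓ : ℕ) (hℓ : 1 ≤ ℓ) (amin aplus m2plus : ℝ) (ha : 0 < amin) :
    ∃ C : ℝ, 0 < C ∧ ∀ (creg β : ℝ), 0 ≤ creg → 0 < β → ∀ (S : ℕ),
      ∃ e₁ : ℝ, 0 < e₁ ∧ ∀ (k : ℕ), 1 ≤ k → ∀ (hn : 1 ≤ (ℓ + 1) ^ k) (a m2 : ℝ),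
      amin ≤ a → a ≤ aplus → 0 ≤ m2 → m2 ≤ m2plus →
      ∀ (M : Fin (d + 1) → ℕ), (∀ i, 1 ≤ M i) → (∀ i, M i ≤ S) → (∀ i, 3 ≤ (ℓ + 1) ^ k * M i) →
      ∀ (Ac : (Fin (d + 1) → ℤ) → Fin (d + 1) → ℝ) (e : ℝ), 0 < e → e ≤ e₁ →
        (∀ x ∈ Box d ℓ k M, ∀ μ ν : Fin (d + 1),
          |Ac (x + e1 μ) ν - Ac x ν| ≤ creg * e ^ (β - 1) / ((ℓ + 1) ^ k : ℕ)) →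
      ∀ Φ : ↥(Box d ℓ k M) × ι → ℝ,
        supN (greenA d F (e / ((ℓ + 1) ^ k : ℕ)) ℓ k a m2 M (baseEmb hn M) (stairContour hn M)
            (fun u v => compField Ac u.1 v.1) *ᵥ Φ) ≤ C * supN Φ ∧
        ∀ μ : Fin (d + 1),
          supN (derivA d F (e / ((ℓ + 1) ^ k : ℕ)) ℓ k M (fun u v => compField Ac u.1 v.1) μ
              *ᵥ (greenA d F (e / ((ℓ + 1) ^ k : ℕ)) ℓ k a m2 M (baseEmb hn M) (stairContour hn M)
                  (fun u v => compField Ac u.1 v.1) *ᵥ Φ)) ≤ C * supN Φ := by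
  obtain ⟨c, hc, hL⟩ := lemma22_17_sup_stair_face F hℓ₁ hLip 1 d ℓ hℓ amin aplus m2plus ha
  set C : ℝ := (1 + ℓ₁) * (2 * (((d : ℝ) + 2) * c)) with hC_def
  have hC0 : 0 < C := by rw [hC_def]; positivity
  refine ⟨C, hC0, fun creg β hcreg hβ S => ?_⟩
  obtain ⟨e₁, he₁, hth⟩ := noCollar_threshold d (c := c) (aplus := aplus) hℓ₁ hc.le ha hcreg hβ S
  refine ⟨e₁, he₁, ?_⟩
  intro k hk hn a m2 e1' e2 e3 e4 M hM hS hN3 Ac e he hle h17 Φ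
  obtain ⟨hak1, hak2⟩ := aSeq_window hℓ hk ha e1' e2
  obtain ⟨hθ1, hsm2, hsm⟩ := hth e he hle _ hak1 hak2
  obtain ⟨-, hA', hder, hface⟩ := gBond_hyps (d := d) hn hS hN3 hcreg he h17
  set n : ℕ := (ℓ + 1) ^ k with hn_def
  set A' : ↥(Box d ℓ k M) → ↥(Box d ℓ k M) → ℝ := gBond (e / n) (fun i => n * M i) Ac with hA'_def
  have hpow : 0 < e ^ β := Real.rpow_pos_of_pos he β
  have hC1n := C1_nonneg d
  have hC2n := C2_nonneg d
  have hθ0 : 0 ≤ (C2 d + S * C1 d) * creg * e ^ β := by positivity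
  have hθ'0 : 0 ≤ C1 d * creg * e ^ β := by positivity
  have hθf0 : 0 ≤ C2 d * creg * e ^ β := by positivity
  have hmem := hL k hk hn a m2 e1' e2 e3 e4 M hM 0 A' _ _ _ hθ0 hA' hθ'0 hder hθf0 hface hsm2 hsm
  rw [constBond_zero, zero_add] at hmem
  -- both members with the common constant `C`, at charge `1` for `A'`
  have hc2 : 0 ≤ 2 * (((d : ℝ) + 2) * c) := by positivity
  have hCa : 2 * (((d : ℝ) + 2) * c) ≤ C := by rw [hC_def]; nlinarith
  have hCb : (1 + ℓ₁ * ((C2 d + S * C1 d) * creg * e ^ β)) * (2 * (((d : ℝ) + 2) * c)) ≤ C := by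
    rw [hC_def]
    refine mul_le_mul_of_nonneg_right ?_ hc2
    have : ℓ₁ * ((C2 d + S * C1 d) * creg * e ^ β) ≤ ℓ₁ * 1 := mul_le_mul_of_nonneg_left hθ1 hℓ₁
    linarith
  have hG : ∀ Ψ, supN (greenA d F 1 ℓ k a m2 M (baseEmb hn M) (stairContour hn M) A' *ᵥ Ψ) ≤ C * supN Ψ := by
    intro Ψ
    have h1 := (hmem Ψ).1
    have hsum : 0 ≤ ∑ μ, supN (derivA0 d F 1 ℓ k M 0 μ
        *ᵥ (greenA d F 1 ℓ k a m2 M (baseEmb hn M) (stairContour hn M) A' *ᵥ Ψ)) :=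
      Finset.sum_nonneg fun μ _ => supN_nonneg _
    exact ((le_add_of_nonneg_right hsum).trans h1).trans (mul_le_mul_of_nonneg_right hCa (supN_nonneg Ψ))
  have hD : ∀ (μ : Fin (d + 1)) Ψ, supN (derivA d F 1 ℓ k M A' μ
      *ᵥ (greenA d F 1 ℓ k a m2 M (baseEmb hn M) (stairContour hn M) A' *ᵥ Ψ)) ≤ C * supN Ψ :=
    fun μ Ψ => ((hmem Ψ).2 μ).trans (mul_le_mul_of_nonneg_right hCb (supN_nonneg Ψ))
  -- the gauge step: `(e/n)A = (A')^{σ}`, `σ = (e/n)λ`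
  have hgauge := sup_hyps_conj
    (F.isGauge (fun u : ↥(Box d ℓ k M) => 1 * gSig (e / n) (fun i => n * M i) Ac u)) hG hD
  have hend : ∀ y x, blkWt n M (fun i => n * M i) y x ≠ 0 →
      pathEnd (baseEmb hn M y) (stairContour hn M y x) = x := fun y x hw => stairContour_end hn M y x hw
  have hfield : (fun u v : ↥(Box d ℓ k M) => e / n * compField Ac u.1 v.1)
      = bondGauge (gSig (e / n) (fun i => n * M i) Ac) A' :=
    (bondGauge_gBond (e / n) (fun i => n * M i) Ac).symm
  have hGeq : greenA d F (e / n) ℓ k a m2 M (baseEmb hn M) (stairContour hn M) (fun u v => compField Ac u.1 v.1)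
      = blockDiag (fun u => F.U (1 * gSig (e / n) (fun i => n * M i) Ac u))
          * greenA d F 1 ℓ k a m2 M (baseEmb hn M) (stairContour hn M) A'
          * (blockDiag fun u => F.U (1 * gSig (e / n) (fun i => n * M i) Ac u))ᵀ := by
    rw [greenA_smul, hfield]
    dsimp only [greenA]
    rw [b4Green_bondGauge F 1 _ m2 _ hend]
  have hDeq : ∀ μ, derivA d F (e / n) ℓ k M (fun u v => compField Ac u.1 v.1) μ
      = blockDiag (fun u => F.U (1 * gSig (e / n) (fun i => n * M i) Ac u))
          * derivA d F 1 ℓ k M A' μ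
          * (blockDiag fun u => F.U (1 * gSig (e / n) (fun i => n * M i) Ac u))ᵀ := by
    intro μ
    rw [derivA_smul, hfield]
    dsimp only [derivA]
    rw [fieldLink_bondGauge, covDeriv_gauge (F.isGauge _)]
  refine ⟨?_, fun μ => ?_⟩
  · rw [hGeq]; exact hgauge.1 Φ
  · rw [hGeq, hDeq μ]; exact hgauge.2 μ Φ

/-! ## §4. The factor bound (2.20) for [B4]'s `h_j`, any label, at a (1.7)-regular `A` with NO collar -/

/-- **(2.20) «‖K_jG_k(□_j,Ã_j)h_j‖_∞ ≤ c₂O(1)M⁻¹» AT `Ã_j = A` FOR A (1.7)-REGULAR `A` WITH NO COLLAR, ANY LABEL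
`j`** (face labels of a parallelepiped included): there is `C > 0` such that for every `(c, β)`, `β > 0`, side bound
`S` and large-cube size `K ≥ 1` there is `e₁ > 0` with: for every mesh `n = L^k` (`nK ≥ 3`), `a, m²` of the windows,
box `□ = Π_μ[0, nM_μ)` (`1 ≤ M_μ ≤ S`, `K ∣ M_μ`), EVERY label `j`, every (1.7)-regular `A` on `□` and
`0 < e ≤ e₁`: `‖K_{h_j}G_k(□,A)(h_jΦ)‖_∞ ≤ (C/K)‖Φ‖_∞`, `h_j = hBox n K M j` — §3 fed to p35's reduction
`eq220_field_reduction_sup` with the sizes `hsize_hBox`.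
[cite: Balaban1983RegularityDecay, (2.20) p. 578 «c₂O(1)M⁻¹» with p. 579 «we can apply Lemma 2.2 to all operators in it» and (1.7) p. 572] -/
theorem eq220_noCollar (F : OrthFlow ι) {ℓ₁ : ℝ} (hℓ₁ : 0 ≤ ℓ₁)
    (hLip : ∀ t (v : ι → ℝ), ((F.U t - 1) *ᵥ v) ⬝ᵥ ((F.U t - 1) *ᵥ v) ≤ (ℓ₁ * t) ^ 2 * (v ⬝ᵥ v))
    (d ℓ : ℕ) (hℓ : 1 ≤ ℓ) (amin aplus m2plus : ℝ) (ha : 0 < amin) :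
    ∃ C : ℝ, 0 < C ∧ ∀ (creg β : ℝ), 0 ≤ creg → 0 < β → ∀ (S K : ℕ), 1 ≤ K →
      ∃ e₁ : ℝ, 0 < e₁ ∧ ∀ (k : ℕ), 1 ≤ k → ∀ (hn : 1 ≤ (ℓ + 1) ^ k), 3 ≤ (ℓ + 1) ^ k * K →
      ∀ (a m2 : ℝ), amin ≤ a → a ≤ aplus → 0 ≤ m2 → m2 ≤ m2plus →
      ∀ (M : Fin (d + 1) → ℕ), (∀ i, 1 ≤ M i) → (∀ i, M i ≤ S) → (∀ μ, K ∣ M μ) →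
      ∀ (j : Fin (d + 1) → ℤ) (Ac : (Fin (d + 1) → ℤ) → Fin (d + 1) → ℝ) (e : ℝ), 0 < e → e ≤ e₁ →
        (∀ x ∈ Box d ℓ k M, ∀ μ ν : Fin (d + 1),
          |Ac (x + e1 μ) ν - Ac x ν| ≤ creg * e ^ (β - 1) / ((ℓ + 1) ^ k : ℕ)) →
      ∀ Φ : ↥(Box d ℓ k M) × ι → ℝ,
        supN (kOp F (e / ((ℓ + 1) ^ k : ℕ)) ((ℓ + 1) ^ k) (B1.aSeq a ((ℓ : ℝ) + 1) k) m2 M (baseEmb hn M)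
              (stairContour hn M) (fun u v => compField Ac u.1 v.1) (hBox ((ℓ + 1) ^ k) K M j)
            *ᵥ (greenA d F (e / ((ℓ + 1) ^ k : ℕ)) ℓ k a m2 M (baseEmb hn M) (stairContour hn M)
                (fun u v => compField Ac u.1 v.1)
                *ᵥ (mulH (ι := ι) (hBox ((ℓ + 1) ^ k) K M j) *ᵥ Φ)))
          ≤ C / K * supN Φ := by
  obtain ⟨C₀, hC₀, hL⟩ := lemma22_sup_noCollar F hℓ₁ hLip d ℓ hℓ amin aplus m2plus ha
  set s : ℝ := ((d : ℝ) + 1) * (D1 hprof + D2 hprof) with hs_def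
  have hs : 0 ≤ s := by
    have := D1_nonneg contDiff_hprof hasCompactSupport_hprof
    have := D2_nonneg contDiff_hprof hasCompactSupport_hprof
    rw [hs_def]; positivity
  set C : ℝ := (2 * ((d : ℝ) + 1) + 1 + |aplus|) * (s + 1) * C₀ with hC_def
  have hC : 0 < C := by rw [hC_def]; positivity
  refine ⟨C, hC, fun creg β hcreg hβ S K hK1 => ?_⟩
  obtain ⟨e₁, he₁, hth⟩ := hL creg β hcreg hβ S
  refine ⟨e₁, he₁, ?_⟩
  intro k hk hn hnK a m2 e1' e2 e3 e4 M hM hS hKM j Ac e he hle h17 Φ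
  have hN3 : ∀ i, 3 ≤ (ℓ + 1) ^ k * M i := fun i =>
    hnK.trans (Nat.mul_le_mul_left _ (Nat.le_of_dvd (hM i) (hKM i)))
  have hmem := hth k hk hn a m2 e1' e2 e3 e4 M hM hS hN3 Ac e he hle h17
  obtain ⟨hak1, hak2⟩ := aSeq_window hℓ hk ha e1' e2
  have hak0 : 0 ≤ B1.aSeq a ((ℓ : ℝ) + 1) k := by linarith
  have hanti : ∀ x y : ↥(Box d ℓ k M), (fun u v : ↥(Box d ℓ k M) => compField Ac u.1 v.1) y x
      = -(fun u v : ↥(Box d ℓ k M) => compField Ac u.1 v.1) x y := fun x y => compField_antisymm Ac x.1 y.1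
  have hh := hsize_hBox hn hK1 hnK hKM j
  have hred := eq220_field_reduction_sup (ν := supN) F (e / ((ℓ + 1) ^ k : ℕ)) (B1.aSeq a ((ℓ : ℝ) + 1) k) m2
    M (baseEmb hn M) (stairContour hn M) (fun u v : ↥(Box d ℓ k M) => compField Ac u.1 v.1) hn hanti hak0
    hC₀.le hC₀.le
    (greenA d F (e / ((ℓ + 1) ^ k : ℕ)) ℓ k a m2 M (baseEmb hn M) (stairContour hn M)
      (fun u v => compField Ac u.1 v.1))
    (fun Ψ => (hmem Ψ).1) (fun μ Ψ => (hmem Ψ).2 μ) hh Φ (supN_mulH_le hh.abs_le Φ)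
  refine hred.trans ?_
  have hKr : (1 : ℝ) ≤ K := by exact_mod_cast hK1
  have hKpos : (0 : ℝ) < K := by linarith
  have har := sizes_Minv_field d 1 (B1.aSeq a ((ℓ : ℝ) + 1) k) hKr hs
  have hd0 : (0 : ℝ) ≤ d := Nat.cast_nonneg d
  have hX0 : 0 ≤ 2 * ((d : ℝ) + 1) * 1 + 1 + B1.aSeq a ((ℓ : ℝ) + 1) k := by linarith
  have hX1 : 2 * ((d : ℝ) + 1) * 1 + 1 + B1.aSeq a ((ℓ : ℝ) + 1) k ≤ 2 * ((d : ℝ) + 1) + 1 + |aplus| := by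
    have := le_abs_self aplus; linarith
  calc (2 * ((d : ℝ) + 1) * (s / K) * C₀ + (s / (K : ℝ) ^ 2 + B1.aSeq a ((ℓ : ℝ) + 1) k * (s / K)) * C₀)
        * supN Φ
      = (2 * ((d : ℝ) + 1) * 1 * (s / K) + s / (K : ℝ) ^ 2 + B1.aSeq a ((ℓ : ℝ) + 1) k * (s / K))
          * C₀ * supN Φ := by ring
    _ ≤ ((2 * ((d : ℝ) + 1) * 1 + 1 + B1.aSeq a ((ℓ : ℝ) + 1) k) * s / K) * C₀ * supN Φ :=
        mul_le_mul_of_nonneg_right (mul_le_mul_of_nonneg_right har hC₀.le) (supN_nonneg Φ)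
    _ = ((2 * ((d : ℝ) + 1) * 1 + 1 + B1.aSeq a ((ℓ : ℝ) + 1) k) * s * C₀) / K * supN Φ := by ring
    _ ≤ C / K * supN Φ := by
        refine mul_le_mul_of_nonneg_right (div_le_div_of_nonneg_right ?_ hKpos.le) (supN_nonneg Φ)
        rw [hC_def]
        exact mul_le_mul_of_nonneg_right (mul_le_mul hX1 (by linarith) hs (by positivity)) hC₀.le

end NoCollar

end

end Literature.MathematicalPhysics.QuantumFieldTheory.Balaban1983to89.B4Lemma22BoxNoCollar
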